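import Literature.MathematicalPhysics.QuantumFieldTheory.Balaban1983to89.Node00.TransportOfRecordGaugeFixing
import Literature.MathematicalPhysics.QuantumFieldTheory.Balaban1983to89.Node00.AveragingSkewPresentation

/-!
# NODE 00 — GAUGE FIXING UNDER THE δ-FUNCTION, SEPARATED EDITION: the Faddeev–Popov weight of [III] (1.5)⇒(1.6) ∕ p. 265 INSIDE THE
# INNER READING of the separated transport (the fine gauge transformations SUPPORTED IN THE GAUGE-FIXED BLOCKS suffice)

HEADER — WORK-UNIT METADATA.  Cell `pub-ymgap`, YM-PLAN Track A (HUMAN RULING D-0062), R134 fan-out seat `pub-ymgap-dag-n11-e` (g22) on node N11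
[B14], strategy s3; route `BalabanUVNodes`, key item K1⁸ `StabilityBRunRowsAtRecordR13SepCoPH` = stmt-QuantumFields-26907 (KEY MAP of record; helper,
`--kind proof --supports 26907`, count-neutral).  [I] = [Balaban1987RG1], [III] = [Balaban1988Convergent].  FILE 3 of this seat's g22 series — asked BY NAME
by dag-n11-d g15 («n11-e take (o2)»: the `sV`-SEPARATED edition of the gauge-fixing faces, so that the inner reading `Fᵢ` ∕ `hin` ∕ `hinnerSum` ∕ `hinner₀` of
`…N11TStepOfRecordSeparated` ∕ `…N11TStepBranchSum` may carry the weight in).  Over, BY NAME and unmodified: p28's `B14Eq16FaddeevPopov` ((1.5)⇒(1.6); its §1 proof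
is RE-RUN here under a weaker hypothesis, credited step by step), r09's `B12FaddeevPopov016` (`FineGauge`, `fpIntegrand`, `fineTransf`, `holTo_gaugeAct_fineTransf`,
`integral_comp_gaugeAct`, `fp015`), this seat's FILE 1 `Node00/TransportOfRecordGaugeFixing` (★ THE PRINCIPLE `kernelTransport_ae_eq_of_forall_integral_mul_comp_eq'`)
and p612977 `Node00/AveragingSkewPresentation` (`fieldMeasure_eq_map_piEquivPiSubtypeProd_symm`, `map_prod_avOfRecord_glue_skew_absolutelyContinuous`).

WHY.  Print fixes the gauge «only on the blocks `B(y)`, `y ∈ P₁¹`» ([III] p. 247) — at step `k` on the blocks of `(P″_{k+1} ∪ Z_k^{∼5})ᶜ` (p. 265 L.10–12) —, and the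
Faddeev–Popov procedure there uses ONLY the gauge transformations `u` with `u(y) = 1` at the centres AND `u = 1` off those blocks.  p28 typed (1.5)⇒(1.6) for integrands
invariant under the WHOLE fine gauge group; the inner reading of the separated transport (dag-n11-w2 p614048 ∕ dag-n11-d p616225: outside fine variables `q.1` on the
bond set `sV` CARRIED, inside variables averaged) is invariant only under transformations not touching `sV` — exactly print's supported ones when the gauge-fixed blocks
lie inside `Ω_{k+1}` and `sV = bondsIn k (Ω_{k+1})ᶜ`.  THIS FILE: §1 re-runs p28's proof with the Faddeev–Popov parameter restricted to the blocks over `Y` (so only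
the supported invariance is consumed); §2 moves it under the δ-function for ANY measurable coarse reading `π` (FILE 1's principle) and through ANY product presentation
`e` of the fine carrier; §3 instantiates at the record in p616225's letters: the inner kernel transport of `(fpW·ρ) ∘ e` equals that of `ρ ∘ e` a.e.

WHAT THIS FILE PROVES (9 theorems + 1 private; 0 `def`, 0 `sorry`, standard axioms).
§1 ★★ `integral_eq_integral_weight_mul_of_invariantOn` — (1.5)⇒(1.6) as a pairing identity `∫dU F = ∫dU fpW(Y)·F` for `F` integrable and invariant under the fine gauge
   transformations SUPPORTED IN THE BLOCKS OVER `Y` (`u (emb y) = 1` for all `y`, `u x = 1` whenever `blockOf x ∉ Y`); `fineTransf_restrict_apply_of_blockOf_not_mem`.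
§2 generic (standard Borel `G`): ★★ `kernelTransport_fpWeight_mul_ae_eq_of_invariantOn` (ANY measurable coarse reading `π : GaugeField → α`, `dU.map π ≪ μ`, `π` and `ρ`
   invariant under the `Y`-supported fine transformations: `kernelTransport dU μ π (fpW·ρ) =ᵐ[μ] kernelTransport dU μ π ρ`) · `integral_comp_presentation` ·
   `integrable_comp_presentation` · ★★ `kernelTransport_presented_fpWeight_mul_ae_eq_of_invariantOn` (the same through a product presentation `e : B × D → GaugeField`,
   `(ν_B ⊗ ν_D).map e = dU`, inner map `ι = π ∘ e`: `kernelTransport (ν_B ⊗ ν_D) μ ι ((fpW·ρ) ∘ e) =ᵐ[μ] kernelTransport (ν_B ⊗ ν_D) μ ι (ρ ∘ e)`).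
§3 AT THE RECORD (`SU(N)`, torus `F.P K`, level `k` of the standing range, `contourOfRecord`, `α > 0`, `ε₀ > 0`): `transportOfRecord_fpWeight_mul_ae_eq_of_invariantOn` (FILE 1 ★★★
   under the supported invariance only) · `gaugeAct_apply_eq_of_mem_bondsIn` · ★★★ `innerTransport_fpWeight_mul_ae_eq` — in p614048∕p616225's letters (`e = (piEquivPiSubtypeProd
   _ (· ∈ sV)).symm`, inner map `q ↦ (q.1, c ↦ avOfRecord … (e q) c)` on `{c ∉ sV'}`, reference `Π_{sV} Haar ⊗ Π_{sV'ᶜ} Haar`): for a fine region `Y₀` saturated at level `k+1`,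
   `sV ⊆ bondsIn k Y₀`, `bondsIn (k+1) Y₀ ⊆ sV'`, gauge-fixed centres `Yfp` with `toFine (k+1) y ∉ Y₀`, `ρ` integrable and invariant under the `Yfp`-supported fine
   transformations: the inner kernel transport of `(fpW·ρ) ∘ e` is a.e. that of `ρ ∘ e`.

NOT IN THIS FILE: the hard tree gauge in separated form (no consumer named it), the choice of `Yfp` of record, (3.6)–(3.9), any chart.

HONEST FRAMING.  Helper lane, count-neutral; p28's proof re-run under a weaker hypothesis + compositions BY NAME; nothing of Bałaban's ESTIMATES asserted; (B4) ∕ (S-α) ∕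
(O3′) NOT closed; N11 NOT discharged; K1⁸ NOT closed; counts unmoved (typed 28∕28 · discharged 5∕27).  One finite four-torus programme at fixed `ε = L^{−K}`; R4 closes
only the conditional finite-𝕋⁴ rung `BalabanLadder.UV` — NOT ℝ⁴, NOT OS, NOT a mass gap, NOT Clay.  No `sorry`, `axiom`, `def`, `instance`, `notation`.  Sources (SHAPE ∕
bookkeeping only): [III] (1.5)–(1.7) p.247, (2.21) p.258, (3.1) p.264, p.265 L.10–12; [I] (0.13)–(0.16) pp.254–255.
-/

noncomputable section

open _root_.MeasureTheory _root_.Function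
open scoped ENNReal BigOperators

namespace Literature.MathematicalPhysics.QuantumFieldTheory.Balaban1983to89.Node00

open T4Continuum (T4Family)
open GaugeField (gaugeAct)
open T4AveragingDisintegration (kernelTransport transportK)
open T4FiniteEpsInhabited (HaarAC)
open B12FaddeevPopov016 (FineGauge FineGaugeInvariant fpIntegrand FPIdx fineTransf fineGauge_fineTransf holTo_gaugeAct_fineTransf
  integral_comp_gaugeAct fp015 abs_fpIntegrand_le_one measurable_fpIntegrand)
open B14Eq16FaddeevPopov (prod_idx_ite integrable_weight_mul avg_gaugeAct_of_fineGauge)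
open B10Eq42TorusConstraint (bondsIn mem_bondsIn_iff)
open B10Eq38TorusDomains (toFine)

/-! ## §1  (1.5)⇒(1.6) for integrands invariant under the fine gauge transformations SUPPORTED IN THE GAUGE-FIXED BLOCKS -/

section SupportedFP

variable {P : Params} {j : ℕ} {G : Type*} [GaugeGroup G]

/-- The Faddeev–Popov parameter RESTRICTED to the blocks over `Y` (extended by `1`) induces a fine transformation that is trivial off those blocks.
[cite: Balaban1988Convergent, (1.5) p.247 (bookkeeping)] -/
theorem fineTransf_restrict_apply_of_blockOf_not_mem (Y : Finset (Site P (j + 1))) (g : FPIdx P j → G) {x : Site P j}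
    (hx : blockOf x ∉ Y) :
    fineTransf (fun i : FPIdx P j => if (i.1 : Site P (j + 1)) ∈ Y then g i else 1) x = 1 := by
  unfold fineTransf
  split_ifs with h
  · show (if ((⟨blockOf x, ⟨x, h⟩⟩ : FPIdx P j).1 : Site P (j + 1)) ∈ Y then g ⟨blockOf x, ⟨x, h⟩⟩ else 1) = 1
    exact if_neg hx
  · rfl

variable [MeasurableSpace G] [HaarData G] [RegularGaugeGroup G]

/-- ★★ **THE FADDEEV–POPOV PROCEDURE FOR A PARTIAL GAUGE FIXING, SUPPORTED INVARIANCE ONLY.**  For a finite set `Y` of block centres of `T^{(j+1)}`, a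
`dU`-integrable `F` invariant under the gauge transformations `u` with `u(emb y) = 1` for every centre AND `u(x) = 1` for every `x` whose block is not over `Y`
(print's «only the blocks B(y), y ∈ P₁¹»), measurable contour variables, `α > 0`, `z ≠ 0`:
`∫dU F(U) = ∫dU [Π_{y∈Y} Π_{x∈B(y),x≠y} (1/z) χ({|U(y,x) − 1| < ε₀}) exp[−(1/α)[1 − Re tr U(y,x)]]] F(U)`.
Proof = p28's `integral_eq_integral_weight_mul` VERBATIM (insert (1.5) = `fp015`, Fubini, substitute, Haar invariance of `dU`), except that the substitution is
`U → U^u` with `u = fineTransf` of the parameter RESTRICTED to `Y` — so only the supported invariance of `F` is used. [cite: Balaban1988Convergent, (1.5)–(1.6) p.247, p.265 L.10–12] -/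
theorem integral_eq_integral_weight_mul_of_invariantOn (hj : j + 1 ≤ P.m + P.K) (cd : ContourData P j G)
    (hcd : ∀ (y : Site P (j + 1)) (x : Site P j), Measurable fun U : GaugeField P j G => cd.holTo U y x)
    {α ε₀ : ℝ} (hα : 0 < α) (hz : B16ZLower.zNorm G α ε₀ ≠ 0) (Y : Finset (Site P (j + 1)))
    {F : GaugeField P j G → ℝ}
    (hF : ∀ u : GaugeTransf P j G, FineGauge u → (∀ x : Site P j, blockOf x ∉ Y → u x = 1) → ∀ U, F (gaugeAct u U) = F U)
    (hFi : Integrable F (fieldMeasure P j G)) :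
    ∫ U, F U ∂(fieldMeasure P j G) =
      ∫ U, (∏ y ∈ Y, ∏ x ∈ (block y).erase (emb y),
        (B16ZLower.zNorm G α ε₀)⁻¹ * fpIntegrand α ε₀ (cd.holTo U y x)) * F U ∂(fieldMeasure P j G) := by
  set z : ℝ := B16ZLower.zNorm G α ε₀ with hzdef
  set η : Measure (FPIdx P j → G) := Measure.pi fun _ => (HaarData.haar : Measure G) with hη
  -- the doubled integrand: one factor (1.5) per pair `(y,x)` with `y ∈ Y`, the factor `1` for the other pairs
  set Φ : GaugeField P j G → (FPIdx P j → G) → ℝ := fun U g =>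
    F U * ∏ i : FPIdx P j, (if (i.1 : Site P (j + 1)) ∈ Y then
      z⁻¹ * fpIntegrand α ε₀ (cd.holTo U i.1 i.2 * (g i)⁻¹) else 1) with hΦ
  -- Step 1 (insert (1.5)): for every `U` the `g`-integral of the product of the factors is `1`.
  have h1 : ∀ U : GaugeField P j G,
      ∫ g, (∏ i : FPIdx P j, (if (i.1 : Site P (j + 1)) ∈ Y then
        z⁻¹ * fpIntegrand α ε₀ (cd.holTo U i.1 i.2 * (g i)⁻¹) else 1)) ∂η = 1 := by
    intro U
    rw [hη, integral_fintype_prod_eq_prod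
      (fun (i : FPIdx P j) (w : G) => if (i.1 : Site P (j + 1)) ∈ Y then
        z⁻¹ * fpIntegrand α ε₀ (cd.holTo U i.1 i.2 * w⁻¹) else 1)]
    refine Finset.prod_eq_one fun i _ => ?_
    by_cases hi : (i.1 : Site P (j + 1)) ∈ Y
    · simp only [hi, if_true]
      rw [integral_const_mul, fp015, hzdef, inv_mul_cancel₀ hz]
    · simp only [hi, if_false]
      simp
  -- Step 2: `∫dU F = ∫dU ∫dg Φ`.
  have h2 : ∫ U, F U ∂(fieldMeasure P j G) = ∫ U, ∫ g, Φ U g ∂η ∂(fieldMeasure P j G) := by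
    refine integral_congr_ae (Filter.Eventually.of_forall fun U => ?_)
    simp only [hΦ]
    rw [integral_const_mul, h1 U, mul_one]
  -- Step 3: Fubini.
  have hΦ_int : Integrable (Function.uncurry Φ) ((fieldMeasure P j G).prod η) := by
    have ha : Integrable (fun p : GaugeField P j G × (FPIdx P j → G) => F p.1) ((fieldMeasure P j G).prod η) :=
      hFi.comp_fst η
    have hb_meas : Measurable (fun p : GaugeField P j G × (FPIdx P j → G) =>
        ∏ i : FPIdx P j, (if (i.1 : Site P (j + 1)) ∈ Y then
          z⁻¹ * fpIntegrand α ε₀ (cd.holTo p.1 i.1 i.2 * (p.2 i)⁻¹) else 1)) := by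
      refine Finset.measurable_prod _ fun i _ => ?_
      by_cases hi : (i.1 : Site P (j + 1)) ∈ Y
      · simp only [hi, if_true]
        have hm1 : Measurable fun p : GaugeField P j G × (FPIdx P j → G) => cd.holTo p.1 i.1 i.2 :=
          (hcd i.1 i.2).comp measurable_fst
        have hm2 : Measurable fun p : GaugeField P j G × (FPIdx P j → G) => (p.2 i)⁻¹ :=
          ((measurable_pi_apply i).comp measurable_snd).inv
        exact (measurable_const.mul (measurable_fpIntegrand α ε₀)).comp (hm1.mul hm2)
      · simp only [hi, if_false]
        exact measurable_const
    have hb_bdd : ∀ p : GaugeField P j G × (FPIdx P j → G),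
        ‖∏ i : FPIdx P j, (if (i.1 : Site P (j + 1)) ∈ Y then
          z⁻¹ * fpIntegrand α ε₀ (cd.holTo p.1 i.1 i.2 * (p.2 i)⁻¹) else 1)‖
          ≤ (max |z|⁻¹ 1) ^ Fintype.card (FPIdx P j) := by
      intro p
      rw [Real.norm_eq_abs, Finset.abs_prod, ← Finset.card_univ, ← Finset.prod_const]
      refine Finset.prod_le_prod (fun i _ => abs_nonneg _) fun i _ => ?_
      by_cases hi : (i.1 : Site P (j + 1)) ∈ Y
      · simp only [hi, if_true]
        rw [abs_mul, abs_inv]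
        calc |z|⁻¹ * |fpIntegrand α ε₀ (cd.holTo p.1 i.1 i.2 * (p.2 i)⁻¹)|
            ≤ |z|⁻¹ * 1 :=
              mul_le_mul_of_nonneg_left (abs_fpIntegrand_le_one hα ε₀ _) (inv_nonneg.2 (abs_nonneg z))
          _ = |z|⁻¹ := mul_one _
          _ ≤ max |z|⁻¹ 1 := le_max_left _ _
      · simp only [hi, if_false, abs_one]
        exact le_max_right _ _
    have h := ha.bdd_mul hb_meas.aestronglyMeasurable (Filter.Eventually.of_forall hb_bdd)
    refine h.congr (Filter.Eventually.of_forall fun p => ?_)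
    simp only [hΦ, Function.uncurry]
    ring
  rw [h2, integral_integral_swap hΦ_int]
  -- Step 4: for fixed `g` gauge-transform `U` by the parameter RESTRICTED to `Y`; the inner integral no longer depends on `g`.
  have h4 : ∀ g : FPIdx P j → G, ∫ U, Φ U g ∂(fieldMeasure P j G) =
      ∫ U, (∏ y ∈ Y, ∏ x ∈ (block y).erase (emb y), z⁻¹ * fpIntegrand α ε₀ (cd.holTo U y x)) * F U
        ∂(fieldMeasure P j G) := by
    intro g
    set g' : FPIdx P j → G := fun i => if (i.1 : Site P (j + 1)) ∈ Y then g i else 1 with hg'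
    have hu : FineGauge (fineTransf g') := fineGauge_fineTransf hj g'
    have hsupp : ∀ x : Site P j, blockOf x ∉ Y → fineTransf g' x = 1 :=
      fun x hx => fineTransf_restrict_apply_of_blockOf_not_mem Y g hx
    have hpt : ∀ U : GaugeField P j G, Φ U g =
        (fun W : GaugeField P j G =>
          (∏ y ∈ Y, ∏ x ∈ (block y).erase (emb y), z⁻¹ * fpIntegrand α ε₀ (cd.holTo W y x)) * F W)
          (gaugeAct (fineTransf g') U) := by
      intro U
      have key := prod_idx_ite Y
        (fun y x => z⁻¹ * fpIntegrand α ε₀ (cd.holTo (gaugeAct (fineTransf g') U) y x))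
      simp only [hΦ]
      rw [hF _ hu hsupp U, ← key]
      simp_rw [holTo_gaugeAct_fineTransf hj cd g' U]
      have hprod : (∏ i : FPIdx P j, (if (i.1 : Site P (j + 1)) ∈ Y then
            z⁻¹ * fpIntegrand α ε₀ (cd.holTo U i.1 i.2 * (g' i)⁻¹) else 1)) =
          ∏ i : FPIdx P j, (if (i.1 : Site P (j + 1)) ∈ Y then
            z⁻¹ * fpIntegrand α ε₀ (cd.holTo U i.1 i.2 * (g i)⁻¹) else 1) := by
        refine Finset.prod_congr rfl fun i _ => ?_
        by_cases hi : (i.1 : Site P (j + 1)) ∈ Y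
        · simp only [hi, if_true, hg']
        · simp only [hi, if_false]
      rw [hprod]
      ring
    simp_rw [hpt]
    exact integral_comp_gaugeAct (fineTransf g') (fun W : GaugeField P j G =>
      (∏ y ∈ Y, ∏ x ∈ (block y).erase (emb y), z⁻¹ * fpIntegrand α ε₀ (cd.holTo W y x)) * F W)
  simp_rw [h4]
  rw [integral_const, hη]
  simp

end SupportedFP

/-! ## §2  Under the δ-function for ANY coarse reading, and through ANY product presentation of the fine carrier -/

section Generic

variable {P : Params} {j : ℕ} {G : Type*} [GaugeGroup G] [MeasurableSpace G] [HaarData G] [RegularGaugeGroup G]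
  [StandardBorelSpace G]
variable {α : Type*} [MeasurableSpace α]

/-- ★★ **THE FADDEEV–POPOV WEIGHT UNDER THE δ-FUNCTION OF ANY COARSE READING.**  For a measurable `π : GaugeField → α` (e.g. `U ↦ Ū`, or the inner reading
`U ↦ (U|_{sV}, Ū|_{sV'ᶜ})` of the separated transport) with `dU.map π ≪ μ`, and `π`, `ρ` invariant under the fine gauge transformations supported in the blocks over `Y`
(`ρ` integrable): `kernelTransport dU μ π (fpW(Y)·ρ) =ᵐ[μ] kernelTransport dU μ π ρ` (FILE 1's principle at the pairing identity of §1 for `F = ρ·(f∘π)`).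
[cite: Balaban1988Convergent, (1.5)–(1.6) p.247, (2.21) p.258, (3.1) p.264] -/
theorem kernelTransport_fpWeight_mul_ae_eq_of_invariantOn (hj : j + 1 ≤ P.m + P.K) (cd : ContourData P j G)
    (hcd : ∀ (y : Site P (j + 1)) (x : Site P j), Measurable fun U : GaugeField P j G => cd.holTo U y x)
    {α₀ ε₀ : ℝ} (hα : 0 < α₀) (hz : B16ZLower.zNorm G α₀ ε₀ ≠ 0) (Y : Finset (Site P (j + 1)))
    {π : GaugeField P j G → α} (hπ : Measurable π) (μ : Measure α) [SigmaFinite μ] (hac : (fieldMeasure P j G).map π ≪ μ)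
    (hπinv : ∀ u : GaugeTransf P j G, FineGauge u → (∀ x : Site P j, blockOf x ∉ Y → u x = 1) → ∀ U, π (gaugeAct u U) = π U)
    {ρ : Density P j G}
    (hρ : ∀ u : GaugeTransf P j G, FineGauge u → (∀ x : Site P j, blockOf x ∉ Y → u x = 1) → ∀ U, ρ (gaugeAct u U) = ρ U)
    (hρi : Integrable ρ (fieldMeasure P j G)) :
    kernelTransport (fieldMeasure P j G) μ π (fun U =>
        (∏ y ∈ Y, ∏ x ∈ (block y).erase (emb y), (B16ZLower.zNorm G α₀ ε₀)⁻¹ * fpIntegrand α₀ ε₀ (cd.holTo U y x)) * ρ U)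
      =ᵐ[μ] kernelTransport (fieldMeasure P j G) μ π ρ := by
  refine kernelTransport_ae_eq_of_forall_integral_mul_comp_eq' (fieldMeasure P j G) μ hπ hac
    (integrable_weight_mul _ cd hcd hα ε₀ _ Y hρi) hρi fun f hf hC => ?_
  obtain ⟨C, hC⟩ := hC
  have hFi : Integrable (fun U => ρ U * f (π U)) (fieldMeasure P j G) :=
    hρi.mul_bdd (hf.comp hπ).aestronglyMeasurable
      (Filter.Eventually.of_forall fun U => by simpa [Real.norm_eq_abs] using hC (π U))
  have hFinv : ∀ u : GaugeTransf P j G, FineGauge u → (∀ x : Site P j, blockOf x ∉ Y → u x = 1) →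
      ∀ U, ρ (gaugeAct u U) * f (π (gaugeAct u U)) = ρ U * f (π U) := fun u hu hs U => by
    rw [hρ u hu hs U, hπinv u hu hs U]
  rw [integral_eq_integral_weight_mul_of_invariantOn hj cd hcd hα hz Y hFinv hFi]
  refine integral_congr_ae (ae_of_all _ fun U => ?_)
  simp only [mul_assoc]

variable {B D : Type*} [MeasurableSpace B] [MeasurableSpace D]

omit [RegularGaugeGroup G] [StandardBorelSpace G] in
/-- Integration through a presentation `e` of the fine carrier (`(ν_B ⊗ ν_D).map e = dU`): `∫ G'(e q) d(ν_B ⊗ ν_D) = ∫ G' dU` for `G'` a.e.-strongly measurable.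
[cite: Balaban1988Convergent, (2.21) p.258 (bookkeeping)] -/
theorem integral_comp_presentation (ν_B : Measure B) (ν_D : Measure D)
    {e : B × D → GaugeField P j G} (he : Measurable e) (hν : (ν_B.prod ν_D).map e = fieldMeasure P j G)
    {G' : GaugeField P j G → ℝ} (hG' : AEStronglyMeasurable G' (fieldMeasure P j G)) :
    ∫ q, G' (e q) ∂(ν_B.prod ν_D) = ∫ U, G' U ∂(fieldMeasure P j G) := by
  have hG'' : AEStronglyMeasurable G' ((ν_B.prod ν_D).map e) := by rw [hν]; exact hG'
  rw [← integral_map he.aemeasurable hG'', hν]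

omit [RegularGaugeGroup G] [StandardBorelSpace G] in
/-- An integrable density read through a presentation is integrable for the presenting product measure. [cite: Balaban1988Convergent, (2.21) p.258 (bookkeeping)] -/
theorem integrable_comp_presentation (ν_B : Measure B) (ν_D : Measure D)
    {e : B × D → GaugeField P j G} (he : Measurable e) (hν : (ν_B.prod ν_D).map e = fieldMeasure P j G)
    {ρ : Density P j G} (hρi : Integrable ρ (fieldMeasure P j G)) :
    Integrable (ρ ∘ e) (ν_B.prod ν_D) := by
  have h1 : Integrable ρ ((ν_B.prod ν_D).map e) := by rw [hν]; exact hρi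
  exact (integrable_map_measure h1.aestronglyMeasurable he.aemeasurable).1 h1

variable [StandardBorelSpace B] [Nonempty B] [StandardBorelSpace D] [Nonempty D]

omit [StandardBorelSpace G] in
/-- ★★ **THE FADDEEV–POPOV WEIGHT INSIDE A PRESENTED (INNER) TRANSPORT.**  For a product presentation `e : B × D → GaugeField` of the fine carrier
(`(ν_B ⊗ ν_D).map e = dU`, finite factors), an inner map `ι : B × D → α` READING THE PRESENTED FIELD (`ι q = π (e q)` for a measurable `π` invariant under the fine
transformations supported in the blocks over `Y`) with `(ν_B ⊗ ν_D).map ι ≪ μ`, and `ρ` integrable with the same supported invariance: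
`kernelTransport (ν_B ⊗ ν_D) μ ι ((fpW(Y)·ρ) ∘ e) =ᵐ[μ] kernelTransport (ν_B ⊗ ν_D) μ ι (ρ ∘ e)`.
[cite: Balaban1988Convergent, (1.5)–(1.6) p.247, (2.21) p.258, (3.1) p.264] -/
theorem kernelTransport_presented_fpWeight_mul_ae_eq_of_invariantOn (hj : j + 1 ≤ P.m + P.K) (cd : ContourData P j G)
    (hcd : ∀ (y : Site P (j + 1)) (x : Site P j), Measurable fun U : GaugeField P j G => cd.holTo U y x)
    {α₀ ε₀ : ℝ} (hα : 0 < α₀) (hz : B16ZLower.zNorm G α₀ ε₀ ≠ 0) (Y : Finset (Site P (j + 1)))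
    (ν_B : Measure B) [IsFiniteMeasure ν_B] (ν_D : Measure D) [IsFiniteMeasure ν_D]
    {e : B × D → GaugeField P j G} (he : Measurable e) (hν : (ν_B.prod ν_D).map e = fieldMeasure P j G)
    {π : GaugeField P j G → α} (hπ : Measurable π)
    (hπinv : ∀ u : GaugeTransf P j G, FineGauge u → (∀ x : Site P j, blockOf x ∉ Y → u x = 1) → ∀ U, π (gaugeAct u U) = π U)
    {ι : B × D → α} (hι : Measurable ι) (hιπ : ∀ q, ι q = π (e q)) (μ : Measure α) [SigmaFinite μ] (hac : (ν_B.prod ν_D).map ι ≪ μ)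
    {ρ : Density P j G}
    (hρ : ∀ u : GaugeTransf P j G, FineGauge u → (∀ x : Site P j, blockOf x ∉ Y → u x = 1) → ∀ U, ρ (gaugeAct u U) = ρ U)
    (hρi : Integrable ρ (fieldMeasure P j G)) :
    kernelTransport (ν_B.prod ν_D) μ ι
        ((fun U => (∏ y ∈ Y, ∏ x ∈ (block y).erase (emb y),
          (B16ZLower.zNorm G α₀ ε₀)⁻¹ * fpIntegrand α₀ ε₀ (cd.holTo U y x)) * ρ U) ∘ e)
      =ᵐ[μ] kernelTransport (ν_B.prod ν_D) μ ι (ρ ∘ e) := by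
  have hwi : Integrable (fun U => (∏ y ∈ Y, ∏ x ∈ (block y).erase (emb y),
      (B16ZLower.zNorm G α₀ ε₀)⁻¹ * fpIntegrand α₀ ε₀ (cd.holTo U y x)) * ρ U) (fieldMeasure P j G) :=
    integrable_weight_mul _ cd hcd hα ε₀ _ Y hρi
  refine kernelTransport_ae_eq_of_forall_integral_mul_comp_eq' (ν_B.prod ν_D) μ hι hac
    (integrable_comp_presentation ν_B ν_D he hν hwi) (integrable_comp_presentation ν_B ν_D he hν hρi) fun f hf hC => ?_
  obtain ⟨C, hC⟩ := hC
  have hfb : ∀ U : GaugeField P j G, ‖f (π U)‖ ≤ C := fun U => by simpa [Real.norm_eq_abs] using hC (π U)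
  have hFi : Integrable (fun U => ρ U * f (π U)) (fieldMeasure P j G) :=
    hρi.mul_bdd (hf.comp hπ).aestronglyMeasurable (Filter.Eventually.of_forall hfb)
  have hWi : Integrable (fun U => ((∏ y ∈ Y, ∏ x ∈ (block y).erase (emb y),
      (B16ZLower.zNorm G α₀ ε₀)⁻¹ * fpIntegrand α₀ ε₀ (cd.holTo U y x)) * ρ U) * f (π U)) (fieldMeasure P j G) :=
    hwi.mul_bdd (hf.comp hπ).aestronglyMeasurable (Filter.Eventually.of_forall hfb)
  have hFinv : ∀ u : GaugeTransf P j G, FineGauge u → (∀ x : Site P j, blockOf x ∉ Y → u x = 1) →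
      ∀ U, ρ (gaugeAct u U) * f (π (gaugeAct u U)) = ρ U * f (π U) := fun u hu hs U => by
    rw [hρ u hu hs U, hπinv u hu hs U]
  -- both pairings are integrals over `dU` through the presentation
  have e1 : ∫ q, ((fun U => (∏ y ∈ Y, ∏ x ∈ (block y).erase (emb y),
        (B16ZLower.zNorm G α₀ ε₀)⁻¹ * fpIntegrand α₀ ε₀ (cd.holTo U y x)) * ρ U) ∘ e) q * f (ι q) ∂(ν_B.prod ν_D) =
      ∫ U, ((∏ y ∈ Y, ∏ x ∈ (block y).erase (emb y),
        (B16ZLower.zNorm G α₀ ε₀)⁻¹ * fpIntegrand α₀ ε₀ (cd.holTo U y x)) * ρ U) * f (π U) ∂(fieldMeasure P j G) := by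
    simp_rw [hιπ]
    exact integral_comp_presentation ν_B ν_D he hν hWi.aestronglyMeasurable
  have e2 : ∫ q, (ρ ∘ e) q * f (ι q) ∂(ν_B.prod ν_D) = ∫ U, ρ U * f (π U) ∂(fieldMeasure P j G) := by
    simp_rw [hιπ]
    exact integral_comp_presentation ν_B ν_D he hν hFi.aestronglyMeasurable
  rw [e1, e2, integral_eq_integral_weight_mul_of_invariantOn hj cd hcd hα hz Y hFinv hFi]
  refine integral_congr_ae (ae_of_all _ fun U => ?_)
  simp only [mul_assoc]

end Generic

/-! ## §3  AT THE RECORD: the weight inside the inner reading of the separated transport (p614048 ∕ p616225's letters) -/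

section Record

variable (F : T4Family) (N : ℕ) [NeZero N]

/-- **FILE 1's ★★★ under the SUPPORTED invariance only**: for `k < K`, gauge-fixed centres `Yfp`, `α > 0`, `ε₀ > 0` and `ρ` integrable and invariant under the fine
transformations supported in the blocks over `Yfp`: `transportOfRecord k (fpW(Yfp)·ρ) =ᵐ[dV] transportOfRecord k ρ`.
[cite: Balaban1988Convergent, (1.5)–(1.6) p.247, p.265 L.10–12, (3.1) p.264] -/
theorem transportOfRecord_fpWeight_mul_ae_eq_of_invariantOn {K k : ℕ} (hk : k < K) {α ε₀ : ℝ} (hα : 0 < α) (hε : 0 < ε₀)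
    (Yfp : Finset (Site (F.P K) (k + 1))) {ρ : Density (F.P K) k (SU N)}
    (hρ : ∀ u : GaugeTransf (F.P K) k (SU N), FineGauge u → (∀ x, blockOf x ∉ Yfp → u x = 1) → ∀ U, ρ (gaugeAct u U) = ρ U)
    (hρi : Integrable ρ (fieldMeasure (F.P K) k (SU N))) :
    transportOfRecord F N K k (fun U =>
        (∏ y ∈ Yfp, ∏ x ∈ (block y).erase (emb y),
          (B16ZLower.zNorm (SU N) α ε₀)⁻¹ * fpIntegrand α ε₀ ((contourOfRecord F N K k).holTo U y x)) * ρ U)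
      =ᵐ[fieldMeasure (F.P K) (k + 1) (SU N)] transportOfRecord F N K k ρ := by
  have hk' : k + 1 ≤ (F.P K).m + (F.P K).K := by simp only [T4Family.P_K, T4Family.P_m]; omega
  exact kernelTransport_fpWeight_mul_ae_eq_of_invariantOn hk' (contourOfRecord F N K k) (measurable_holTo_contourOfRecord F N K k)
    hα (B12FaddeevPopov016TwoLevel.zNorm_specialUnitaryGroup_pos hα hε).ne' Yfp (avOfRecord_measurable F N K k)
    (fieldMeasure (F.P K) (k + 1) (SU N)) (avOfRecord_haarAC F N K k hk)
    (fun u hu _ U => avOfRecord_gaugeAct_of_fineGauge F N hk hu U) hρ hρi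

/-- A fine transformation supported in blocks whose level-`(k+1)` images lie outside a region `Y₀` saturated at level `k+1` does not move the variables on the bonds
of `Y₀`: `(U^u)(b) = U(b)` for `b ∈ bondsIn k Y₀`. [cite: Balaban1988Convergent, (3.1) p.264 (bookkeeping); Balaban1987RG1, (0.1) p.251 (bookkeeping)] -/
theorem gaugeAct_apply_eq_of_mem_bondsIn {K k : ℕ} {Y₀ : Set (Site (F.P K) 0)}
    (hY : ∀ s : Site (F.P K) k, toFine k s ∈ Y₀ ↔ toFine (k + 1) (blockOf s) ∈ Y₀)
    {Yfp : Finset (Site (F.P K) (k + 1))} (hYfp : ∀ y ∈ Yfp, toFine (k + 1) y ∉ Y₀)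
    {u : GaugeTransf (F.P K) k (SU N)} (hu : ∀ x, blockOf x ∉ Yfp → u x = 1)
    {b : PBond (F.P K) k} (hb : b ∈ bondsIn k Y₀) (U : GaugeField (F.P K) k (SU N)) :
    gaugeAct u U b = U b := by
  have hoff : ∀ x : Site (F.P K) k, toFine k x ∈ Y₀ → u x = 1 := fun x hx =>
    hu x fun hmem => hYfp _ hmem ((hY x).1 hx)
  obtain ⟨hs, ht⟩ := mem_bondsIn_iff.1 hb
  show u b.src * U b * (u b.tgt)⁻¹ = U b
  rw [hoff _ hs, show b.tgt = b.src.shift b.dir from rfl, hoff _ ht, inv_one, one_mul, mul_one]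

omit [NeZero N] in
/-- The glue reads the first component on the bonds of `sV`. [folklore] -/
private theorem glue_apply_of_mem {K k : ℕ} [DecidableEq (PBond (F.P K) k)] (sV : Finset (PBond (F.P K) k))
    (q : (↥sV → SU N) × ({b : PBond (F.P K) k // b ∉ sV} → SU N)) (b : ↥sV) :
    (MeasurableEquiv.piEquivPiSubtypeProd (fun _ : PBond (F.P K) k => SU N) (· ∈ sV)).symm q b = q.1 b := by
  show (if h : (b : PBond (F.P K) k) ∈ sV then q.1 ⟨b, h⟩ else q.2 ⟨b, h⟩) = q.1 b
  rw [dif_pos b.2]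

/-- ★★★ **THE FADDEEV–POPOV WEIGHT INSIDE THE INNER READING OF THE SEPARATED TRANSPORT** (dag-n11-w2 p614048 ∕ dag-n11-d p616225's letters): for a level `k` of the
standing range, a fine region `Y₀` saturated at level `k+1` (`hY`), finsets `sV ⊆ bondsIn k Y₀` (the CARRIED outside variables) and `sV' ⊇ bondsIn (k+1) Y₀`, gauge-fixed
centres `Yfp` whose blocks avoid `Y₀` (`toFine (k+1) y ∉ Y₀`; at the record `Y₀ = (Ω_{k+1})ᶜ`: the blocks INSIDE `Ω_{k+1}`), `α > 0`, `ε₀ > 0`, and `ρ` integrable and invariant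
under the fine transformations supported in the blocks over `Yfp`: with `e := (piEquivPiSubtypeProd _ (· ∈ sV)).symm` and the inner map `q ↦ (q.1, c ↦ Ū(e q)(c))` on `{c ∉ sV'}`,
`kernelTransport (Π_{sV}Haar ⊗ Π_{sVᶜ}Haar) (Π_{sV}Haar ⊗ Π_{sV'ᶜ}Haar) ι ((fpW(Yfp)·ρ) ∘ e) =ᵐ kernelTransport … ι (ρ ∘ e)` — so the inner reading `Fᵢ` of `hin` ∕ `hinnerSum` may
carry the weight of (1.6) in. [cite: Balaban1988Convergent, (1.5)–(1.6) p.247, p.265 L.10–12, (2.21) p.258, (3.1) p.264] -/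
theorem innerTransport_fpWeight_mul_ae_eq (K k : ℕ) [DecidableEq (PBond (F.P K) k)] [DecidableEq (PBond (F.P K) (k + 1))]
    (hk : k + 1 ≤ (F.P K).m + (F.P K).K)
    {Y₀ : Set (Site (F.P K) 0)} (hY : ∀ s : Site (F.P K) k, toFine k s ∈ Y₀ ↔ toFine (k + 1) (blockOf s) ∈ Y₀)
    {sV : Finset (PBond (F.P K) k)} (hsV : ∀ b : PBond (F.P K) k, b ∈ sV → b ∈ bondsIn k Y₀)
    {sV' : Finset (PBond (F.P K) (k + 1))} (hsV' : ∀ c : PBond (F.P K) (k + 1), c ∈ bondsIn (k + 1) Y₀ → c ∈ sV')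
    {α ε₀ : ℝ} (hα : 0 < α) (hε : 0 < ε₀)
    (Yfp : Finset (Site (F.P K) (k + 1))) (hYfp : ∀ y ∈ Yfp, toFine (k + 1) y ∉ Y₀)
    {ρ : Density (F.P K) k (SU N)}
    (hρ : ∀ u : GaugeTransf (F.P K) k (SU N), FineGauge u → (∀ x, blockOf x ∉ Yfp → u x = 1) → ∀ U, ρ (gaugeAct u U) = ρ U)
    (hρi : Integrable ρ (fieldMeasure (F.P K) k (SU N))) :
    kernelTransport
        ((Measure.pi fun _ : ↥sV => (HaarData.haar : Measure (SU N))).prod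
          (Measure.pi fun _ : {b : PBond (F.P K) k // b ∉ sV} => (HaarData.haar : Measure (SU N))))
        ((Measure.pi fun _ : ↥sV => (HaarData.haar : Measure (SU N))).prod
          (Measure.pi fun _ : {c : PBond (F.P K) (k + 1) // c ∉ sV'} => (HaarData.haar : Measure (SU N))))
        (fun q => (q.1, fun c : {c : PBond (F.P K) (k + 1) // c ∉ sV'} =>
          (avOfRecord F N K k).avg ((MeasurableEquiv.piEquivPiSubtypeProd (fun _ : PBond (F.P K) k => SU N) (· ∈ sV)).symm q) c))
        ((fun U => (∏ y ∈ Yfp, ∏ x ∈ (block y).erase (emb y),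
          (B16ZLower.zNorm (SU N) α ε₀)⁻¹ * fpIntegrand α ε₀ ((contourOfRecord F N K k).holTo U y x)) * ρ U) ∘
          ⇑(MeasurableEquiv.piEquivPiSubtypeProd (fun _ : PBond (F.P K) k => SU N) (· ∈ sV)).symm)
      =ᵐ[(Measure.pi fun _ : ↥sV => (HaarData.haar : Measure (SU N))).prod
          (Measure.pi fun _ : {c : PBond (F.P K) (k + 1) // c ∉ sV'} => (HaarData.haar : Measure (SU N)))]
        kernelTransport
          ((Measure.pi fun _ : ↥sV => (HaarData.haar : Measure (SU N))).prod
            (Measure.pi fun _ : {b : PBond (F.P K) k // b ∉ sV} => (HaarData.haar : Measure (SU N))))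
          ((Measure.pi fun _ : ↥sV => (HaarData.haar : Measure (SU N))).prod
            (Measure.pi fun _ : {c : PBond (F.P K) (k + 1) // c ∉ sV'} => (HaarData.haar : Measure (SU N))))
          (fun q => (q.1, fun c : {c : PBond (F.P K) (k + 1) // c ∉ sV'} =>
            (avOfRecord F N K k).avg ((MeasurableEquiv.piEquivPiSubtypeProd (fun _ : PBond (F.P K) k => SU N) (· ∈ sV)).symm q) c))
          (ρ ∘ ⇑(MeasurableEquiv.piEquivPiSubtypeProd (fun _ : PBond (F.P K) k => SU N) (· ∈ sV)).symm) := by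
  set eβ := (MeasurableEquiv.piEquivPiSubtypeProd (fun _ : PBond (F.P K) k => SU N) (· ∈ sV)).symm with heβ
  -- the coarse reading `π U = (U|_{sV}, Ū|_{sV'ᶜ})` on the FULL fine carrier, of which the inner map is the presented form
  set π : GaugeField (F.P K) k (SU N) → (↥sV → SU N) × ({c : PBond (F.P K) (k + 1) // c ∉ sV'} → SU N) :=
    fun U => (fun b : ↥sV => U (b : PBond (F.P K) k),
      fun c : {c : PBond (F.P K) (k + 1) // c ∉ sV'} => (avOfRecord F N K k).avg U (c : PBond (F.P K) (k + 1))) with hπ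
  have hπ1 : Measurable fun U : GaugeField (F.P K) k (SU N) => fun b : ↥sV => U (b : PBond (F.P K) k) :=
    measurable_pi_lambda _ fun b => measurable_pi_apply (b : PBond (F.P K) k)
  have hπ2 : Measurable fun U : GaugeField (F.P K) k (SU N) =>
      fun c : {c : PBond (F.P K) (k + 1) // c ∉ sV'} => (avOfRecord F N K k).avg U (c : PBond (F.P K) (k + 1)) :=
    measurable_pi_lambda _ fun c => (measurable_pi_apply (c : PBond (F.P K) (k + 1))).comp (avOfRecord_measurable F N K k)
  have hπm : Measurable π := hπ1.prodMk hπ2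
  have hπinv : ∀ u : GaugeTransf (F.P K) k (SU N), FineGauge u → (∀ x, blockOf x ∉ Yfp → u x = 1) →
      ∀ U, π (gaugeAct u U) = π U := by
    intro u hu hs U
    simp only [hπ]
    refine Prod.ext (funext fun b => ?_) (funext fun c => ?_)
    · exact gaugeAct_apply_eq_of_mem_bondsIn F N hY hYfp hs (hsV b b.2) U
    · simp only [avg_gaugeAct_of_fineGauge hk (avOfRecord F N K k) hu U]
  have hιπ : ∀ q : (↥sV → SU N) × ({b : PBond (F.P K) k // b ∉ sV} → SU N),
      (q.1, fun c : {c : PBond (F.P K) (k + 1) // c ∉ sV'} => (avOfRecord F N K k).avg (eβ q) c) = π (eβ q) := by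
    intro q
    simp only [hπ]
    refine Prod.ext (funext fun b => ?_) rfl
    exact (glue_apply_of_mem F N sV q b).symm
  have hι : Measurable fun q : (↥sV → SU N) × ({b : PBond (F.P K) k // b ∉ sV} → SU N) =>
      (q.1, fun c : {c : PBond (F.P K) (k + 1) // c ∉ sV'} => (avOfRecord F N K k).avg (eβ q) c) := by
    have : (fun q : (↥sV → SU N) × ({b : PBond (F.P K) k // b ∉ sV} → SU N) =>
        (q.1, fun c : {c : PBond (F.P K) (k + 1) // c ∉ sV'} => (avOfRecord F N K k).avg (eβ q) c)) = π ∘ eβ :=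
      funext hιπ
    rw [this]
    exact hπm.comp eβ.measurable
  exact kernelTransport_presented_fpWeight_mul_ae_eq_of_invariantOn hk (contourOfRecord F N K k)
    (measurable_holTo_contourOfRecord F N K k) hα (B12FaddeevPopov016TwoLevel.zNorm_specialUnitaryGroup_pos hα hε).ne' Yfp
    (Measure.pi fun _ : ↥sV => (HaarData.haar : Measure (SU N)))
    (Measure.pi fun _ : {b : PBond (F.P K) k // b ∉ sV} => (HaarData.haar : Measure (SU N)))
    eβ.measurable (fieldMeasure_eq_map_piEquivPiSubtypeProd_symm sV).symm hπm hπinv hι hιπ _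
    (map_prod_avOfRecord_glue_skew_absolutelyContinuous F N K k hk hY hsV hsV') hρ hρi

end Record

end Literature.MathematicalPhysics.QuantumFieldTheory.Balaban1983to89.Node00

end
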